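import Mathlib.NumberTheory.Real.Irrational
import Literature.NumberTheory.EllipticCurves.TwoIsogenyShaTwoTorsion
import Literature.NumberTheory.EllipticCurves.TwoIsogenyDescentIndex
import Literature.NumberTheory.EllipticCurves.TwoIsogenySelmerGroupRankProofs
import Literature.NumberTheory.EllipticCurves.BinaryQuarticLocalSolubility
import Summits.BirchSwinnertonDyer.Rank1Residual.ManinAdditive.ShimuraLedger
import HarnessLib

/-!
# The blind families are `2`-Selmer-minimal, I: the Selmer groups of `E'_m : y² = x³ − 2m x² + (m² + 4) x`

Summit `BirchSwinnertonDyer`, route `ManinLocalTwoThree` (cell bsd-f2-manin), crux C2 `ManinOddAtFour`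
(stmt-BirchSwinnertonDyer-22967), the TOTALLY-BLIND residual (stubs 6d/6e of `Lines/kato_shift_two.lean`: the `X₀`-optimal blind
curves `ShimuraLedger.blindCurve m`, `m` odd, `p = m² + 4` prime, `N = 4p` / `16p`).  PORT (lead p1 g5) of Part A §0–§2 of the
-an planner's kernel-checked sketch HOME/an/Sketch-an-g23.lean (an g23, MEMO-an §65; farm rc 0, axioms standard), namespace
moved under `Theorems`; statements and proofs VERBATIM.  Complete descent via `2`-isogeny (Silverman–Tate §3.4–3.6, Silverman AEC
X.4.9 / Example X.4.10 as typed in the tree, `(a, b) = (−2m, p)`, `a² − 4b = −16`):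

* `not_isSoluble_real_negOne` — the classes `−1`, `−p` of `S(−2m, p)` die over `ℝ`;
* `not_isSoluble_two_of_zmod16` — the classes `±2` of `S(4m, −16)` die in `ℚ₂` (a `decide` modulo `16`);
* `selmer_blind_eq : S(−2m, p) = {1, p}`, `selmer'_blind_eq : S'(−2m, p) = {1, −1}`.

Part II (`…BlindFamilyTwoDescent.lean`): rank `0` and `Ш[2] = 0` for both curves of the class.  Nothing about BSD or Manin's
conjecture is proved; nothing is asserted about `c`. [cite: SilvermanTate2015, §3.4–3.6] [cite: SilvermanAEC2009, X.4.9 and Example X.4.10]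
-/

set_option autoImplicit false
set_option linter.dupNamespace false

noncomputable section

open scoped Classical

namespace Summit.BirchSwinnertonDyer.BirchSwinnertonDyer.Theorems.ManinLocalTwoThree.BlindFamilyDescent

open _root_.WeierstrassCurve _root_.WeierstrassCurve.Affine
open Literature.NumberTheory.EllipticCurves Literature.NumberTheory.DiophantineGeometry
open Summit.BirchSwinnertonDyer.Rank1Residual.ManinAdditive.ShimuraLedger (blindCurve sourceCurve)

/-! ## 0. Arithmetic helpers -/

/-- The integer divisors of a prime `p` are `±1, ±p`. [folklore] -/
theorem eq_of_dvd_prime {p : ℕ} (hp : p.Prime) {d : ℤ} (hd : d ∣ (p : ℤ)) :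
    d = 1 ∨ d = -1 ∨ d = p ∨ d = -(p : ℤ) := by
  have h1 : d.natAbs ∣ p := by
    have := Int.natAbs_dvd_natAbs.mpr hd
    simpa using this
  rcases (Nat.dvd_prime hp).mp h1 with h | h <;>
    rcases Int.natAbs_eq d with h' | h' <;> rw [h] at h' <;> simp [h']

/-- The squarefree integer divisors of `−16` are `±1, ±2`. [folklore] -/
theorem eq_of_squarefree_dvd_neg_sixteen {d : ℤ} (hsq : Squarefree d) (hd : d ∣ (-16 : ℤ)) :
    d = 1 ∨ d = -1 ∨ d = 2 ∨ d = -2 := by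
  have h16 : d.natAbs ∣ 16 := by
    have := Int.natAbs_dvd_natAbs.mpr hd
    simpa using this
  have h1 : d.natAbs ∣ 2 ^ 4 := by norm_num; exact h16
  have hsq' : Squarefree d.natAbs := Int.squarefree_natAbs.mpr hsq
  have htwo : ¬ IsUnit (2 : ℕ) := fun h => absurd (Nat.isUnit_iff.mp h) (by norm_num)
  obtain ⟨i, hi, hi'⟩ := (Nat.dvd_prime_pow Nat.prime_two).mp h1
  interval_cases i
  · rcases Int.natAbs_eq d with h' | h' <;> rw [hi'] at h' <;> simp [h']
  · rcases Int.natAbs_eq d with h' | h' <;> rw [hi'] at h' <;> simp [h']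
  · exact absurd (hsq' 2 (by rw [hi']; norm_num)) htwo
  · exact absurd (hsq' 2 (by rw [hi']; norm_num)) htwo
  · exact absurd (hsq' 2 (by rw [hi']; norm_num)) htwo

/-- `b / d = d'` from `d · d' = b`. [folklore] -/
theorem ediv_eq_of_mul_eq {b d d' : ℤ} (hd : d ≠ 0) (h : d * d' = b) : b / d = d' := by
  rw [← h, Int.mul_ediv_cancel_left _ hd]

/-! ## 1. The two local kills -/

/-- **Archimedean kill.** `−u⁴ − 2m u²z² − (m² + 4) z⁴ = −((u² + m z²)² + 4 z⁴)` is negative away from the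
origin, so `w² = −u⁴ − 2m u²z² − (m²+4) z⁴` has no real point: the classes `−1` (and, by the symmetry
`(d, u) ↔ (d', z)`, `−(m²+4)`) of `S(−2m, m²+4)` die over `ℝ` — for BOTH signs of `m`. [folklore] -/
theorem not_isSoluble_real_negOne (m P : ℤ) (hP : P = m ^ 2 + 4) :
    ¬ ((twoIsogenyQuartic (-2 * m) (-1) (-P)).map (Int.castRingHom ℝ)).IsSoluble := by
  rintro ⟨u, z, w, h0, h⟩
  rw [eval_map_twoIsogenyQuartic] at h
  simp only [eq_intCast, hP] at h
  push_cast at h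
  have hw := sq_nonneg w
  have hs := sq_nonneg (u ^ 2 + (m : ℝ) * z ^ 2)
  have hz4 : (0 : ℝ) ≤ z ^ 4 := by positivity
  have hu4 : (0 : ℝ) ≤ u ^ 4 := by positivity
  have hlin : w ^ 2 + (u ^ 2 + (m : ℝ) * z ^ 2) ^ 2 + 4 * z ^ 4 = 0 := by linear_combination h
  have hz : z = 0 := pow_eq_zero_iff (n := 4) (by norm_num) |>.mp (by linarith)
  subst hz
  have e : (u ^ 2 + (m : ℝ) * (0 : ℝ) ^ 2) ^ 2 = u ^ 4 := by ring
  have z4 : (0 : ℝ) ^ 4 = 0 := by norm_num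
  have hu : u = 0 := pow_eq_zero_iff (n := 4) (by norm_num) |>.mp (by linarith)
  subst hu
  rcases h0 with h0 | h0 <;> exact h0 rfl

/-- **`2`-adic kill, general form.** If neither `z̄² = d + a t̄² + d' t̄⁴` nor `z̄² = d t̄⁴ + a t̄² + d'` is
solvable in `ℤ/16`, then `w² = d u⁴ + a u²z² + d' z⁴` has no `ℚ₂`-point (a `ℚ₂`-point may be taken in `ℤ₂`
with one coordinate `1`, the tree's `BinaryQuartic.isSoluble_map_coe_iff`). [folklore] -/
theorem not_isSoluble_two_of_zmod16 {a d d' : ℤ}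
    (h : ∀ z t : ZMod (2 ^ 4),
      z ^ 2 ≠ (d : ZMod (2 ^ 4)) + (a : ZMod (2 ^ 4)) * t ^ 2 + (d' : ZMod (2 ^ 4)) * t ^ 4 ∧
      z ^ 2 ≠ (d : ZMod (2 ^ 4)) * t ^ 4 + (a : ZMod (2 ^ 4)) * t ^ 2 + (d' : ZMod (2 ^ 4))) :
    ¬ ((twoIsogenyQuartic a d d').map (Int.castRingHom ℚ_[2])).IsSoluble := by
  intro hsol
  rw [← BinaryQuartic.map_intCast_map_coe, BinaryQuartic.isSoluble_map_coe_iff] at hsol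
  rcases hsol with ⟨t, z, he⟩ | ⟨t, z, he⟩
  · rw [eval_map_twoIsogenyQuartic] at he
    simp only [eq_intCast, one_pow, mul_one] at he
    have hbar := congrArg (PadicInt.toZModPow 4) he
    simp only [map_pow, map_add, map_mul, map_intCast] at hbar
    exact (h _ _).1 hbar
  · rw [eval_map_twoIsogenyQuartic] at he
    simp only [eq_intCast, one_pow, mul_one] at he
    have hbar := congrArg (PadicInt.toZModPow 4) he
    simp only [map_pow, map_add, map_mul, map_intCast] at hbar
    exact (h _ _).2 hbar

/-- The residue computation modulo `16` (`c = 4(2k+1) ∈ {4, 12}`): none of `2 + c t² − 8 t⁴`, `2 t⁴ + c t² − 8`,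
`−2 + c t² + 8 t⁴`, `−2 t⁴ + c t² + 8` is a square in `ℤ/16` (values `2, 6, 14`, resp. `8, 6, 12, 14`,
resp. `14, 2, 10`, resp. `8, 2, 10`). [folklore] -/
theorem zmod16_kill : ∀ k z t : ZMod (2 ^ 4),
    (z ^ 2 ≠ 2 + 4 * (2 * k + 1) * t ^ 2 + -8 * t ^ 4 ∧ z ^ 2 ≠ 2 * t ^ 4 + 4 * (2 * k + 1) * t ^ 2 + -8) ∧
    (z ^ 2 ≠ -2 + 4 * (2 * k + 1) * t ^ 2 + 8 * t ^ 4 ∧ z ^ 2 ≠ -2 * t ^ 4 + 4 * (2 * k + 1) * t ^ 2 + 8) := by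
  decide

/-! ## 2. The Selmer groups of the family -/

section Family

variable {m : ℤ} {p : ℕ} [hp : Fact p.Prime]

omit hp in
/-- `a² − 4b = −16` for `(a, b) = (−2m, p)`, `p = m² + 4`. [folklore] -/
theorem disc_eq (hpm : (p : ℤ) = m ^ 2 + 4) : (-2 * m) ^ 2 - 4 * (p : ℤ) = -16 := by
  rw [hpm]; ring

/-- `b (a² − 4b) = −16 p ≠ 0`. [folklore] -/
theorem hab (hpm : (p : ℤ) = m ^ 2 + 4) : (p : ℤ) * ((-2 * m) ^ 2 - 4 * (p : ℤ)) ≠ 0 := by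
  have hp0 : (p : ℤ) ≠ 0 := by exact_mod_cast hp.out.ne_zero
  rw [disc_eq hpm]
  exact mul_ne_zero hp0 (by norm_num)

/-- **`S^{(φ̂)}(E_m/ℚ) = S(−2m, p) = {1, p}`** (descent on the divisors of `b = p`): `1 = α(O)`, `p = α(T)`;
`−1` and `−p` die over `ℝ`. [cite: SilvermanTate2015, §3.6 eq. (**)] -/
theorem selmer_blind_eq (hpm : (p : ℤ) = m ^ 2 + 4) :
    twoIsogenySelmerGroup (-2 * m) (p : ℤ) = {1, (p : ℤ)} := by
  have hP := hp.out
  have hp0 : (p : ℤ) ≠ 0 := by exact_mod_cast hP.ne_zero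
  have hsqp : Squarefree (p : ℤ) := Int.squarefree_natCast.mpr hP.prime.squarefree
  have hkill : ¬ ((twoIsogenyQuartic (-2 * m) (-1) (-(p : ℤ))).map (Int.castRingHom ℝ)).IsSoluble :=
    not_isSoluble_real_negOne m p hpm
  ext d
  simp only [Finset.mem_insert, Finset.mem_singleton]
  constructor
  · intro hd
    obtain ⟨hsq, hdvd, hloc⟩ := (mem_twoIsogenySelmerGroup_iff hp0).mp hd
    rcases eq_of_dvd_prime hP hdvd with rfl | rfl | rfl | rfl
    · exact Or.inl rfl
    · exfalso
      rw [ediv_eq_of_mul_eq (by norm_num) (show (-1 : ℤ) * (-(p : ℤ)) = p by ring)] at hloc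
      exact hkill hloc.1
    · exact Or.inr rfl
    · exfalso
      rw [ediv_eq_of_mul_eq (neg_ne_zero.mpr hp0) (show (-(p : ℤ)) * (-1) = p by ring)] at hloc
      apply hkill
      have := hloc.1
      rwa [isSoluble_map_twoIsogenyQuartic_comm] at this
  · rintro (rfl | rfl)
    · exact one_mem_twoIsogenySelmerGroup _ hp0
    · exact self_mem_twoIsogenySelmerGroup _ hsqp

omit hp in
/-- **`S^{(φ)}(E'_m/ℚ) = S'(−2m, p) = S(4m, −16) = {1, −1}`** (descent on the divisors of `a² − 4b = −16`):
`1 = ᾱ(O)`, `−1 ≡ −16 = ᾱ(T')`; `±2` die in `ℚ₂` for `m` odd. [cite: SilvermanAEC2009, Prop. X.4.9] -/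
theorem selmer'_blind_eq (hpm : (p : ℤ) = m ^ 2 + 4) (hm : Odd m) :
    twoIsogenySelmerGroup' (-2 * m) (p : ℤ) = {1, -1} := by
  obtain ⟨k, hk⟩ := hm
  have h16 : (-16 : ℤ) ≠ 0 := by norm_num
  have hkill₂ : ¬ ((twoIsogenyQuartic (4 * m) 2 (-8)).map (Int.castRingHom ℚ_[2])).IsSoluble := by
    apply not_isSoluble_two_of_zmod16
    intro z t
    subst hk
    push_cast
    exact (zmod16_kill (k : ZMod (2 ^ 4)) z t).1
  have hkill₃ : ¬ ((twoIsogenyQuartic (4 * m) (-2) 8).map (Int.castRingHom ℚ_[2])).IsSoluble := by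
    apply not_isSoluble_two_of_zmod16
    intro z t
    subst hk
    push_cast
    exact (zmod16_kill (k : ZMod (2 ^ 4)) z t).2
  rw [twoIsogenySelmerGroup'_eq, show -2 * (-2 * m) = 4 * m by ring, disc_eq hpm]
  ext d
  simp only [Finset.mem_insert, Finset.mem_singleton]
  constructor
  · intro hd
    obtain ⟨hsq, hdvd, hloc⟩ := (mem_twoIsogenySelmerGroup_iff h16).mp hd
    rcases eq_of_squarefree_dvd_neg_sixteen hsq hdvd with rfl | rfl | rfl | rfl
    · exact Or.inl rfl
    · exact Or.inr rfl
    · exfalso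
      rw [ediv_eq_of_mul_eq (by norm_num) (show (2 : ℤ) * (-8) = -16 by norm_num)] at hloc
      exact hkill₂ (hloc.2 2)
    · exfalso
      rw [ediv_eq_of_mul_eq (by norm_num) (show (-2 : ℤ) * 8 = -16 by norm_num)] at hloc
      exact hkill₃ (hloc.2 2)
  · rintro (rfl | rfl)
    · exact one_mem_twoIsogenySelmerGroup _ h16
    · exact mem_twoIsogenySelmerGroup_of_isSquare h16 isUnit_one.neg.squarefree ⟨16, by norm_num⟩
        ⟨4, by rw [ediv_eq_of_mul_eq (by norm_num) (show (-1 : ℤ) * 16 = -16 by norm_num)]; norm_num⟩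

/-- `dim₂ S^{(φ̂)} = 1`. [folklore] -/
theorem selmerRank_blind_eq (hpm : (p : ℤ) = m ^ 2 + 4) : twoIsogenySelmerRank (-2 * m) (p : ℤ) = 1 := by
  have h2 : (1 : ℤ) ≠ (p : ℤ) := by exact_mod_cast hp.out.one_lt.ne
  rw [twoIsogenySelmerRank, selmer_blind_eq hpm, Finset.card_insert_of_notMem (by simpa using h2),
    Finset.card_singleton]
  exact Nat.log_pow Nat.one_lt_two 1

omit hp in
/-- `dim₂ S^{(φ)} = 1`. [folklore] -/
theorem selmerRank'_blind_eq (hpm : (p : ℤ) = m ^ 2 + 4) (hm : Odd m) :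
    twoIsogenySelmerRank' (-2 * m) (p : ℤ) = 1 := by
  rw [twoIsogenySelmerRank'_eq, selmer'_blind_eq hpm hm, Finset.card_insert_of_notMem (by simp),
    Finset.card_singleton]
  exact Nat.log_pow Nat.one_lt_two 1


end Family

end Summit.BirchSwinnertonDyer.BirchSwinnertonDyer.Theorems.ManinLocalTwoThree.BlindFamilyDescent

end
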